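import Mathlib
import Summits.AtomisticToContinuum.Crystallization.Theorems.SquareWellLayerCakeGapTwelveToBarlowNoSixCommonNeighbours

/-!
# Five-fold bonds are closed rings — part 1/3: constants, planar and scalar lemmas

Crux `SquareWellLayerCake.GapTwelveToBarlow` (stmt-AtomisticToContinuum-15807), line `Sketch`,
structural lemma S2α behind `stub_fiveFoldSubcubic` (wave-2 worker file, split for the 400-line
limit).  This part: the certified cosine bounds `cos 66° > 2/5`, `cos 96° > −1/9`, the planar
pigeonhole / partner lemmas for unit complex numbers, and the scalar transversal-radius band
`[0.8243, 0.876]` with the three cosine bounds.  See part 2 for the ring lemmas and the module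
overview.  Mathlib + the landed sign-lemma file only.
-/

noncomputable section

namespace Summit.AtomisticToContinuum.Crystallization.Theorems.SquareWellLayerCakeGapTwelveToBarlow

open scoped InnerProductSpace ComplexConjugate Real

/-! ## Two numerical constants -/

/-- `cos 66° = sin 24° > 2/5` (`sin x > x - x³/6`, `π > 3.141592`). [folklore] -/
theorem two_fifths_lt_cos : (2 : ℝ) / 5 < Real.cos (11 * π / 30) := by
  have h : Real.cos (11 * π / 30) = Real.sin (2 * π / 15) := by
    rw [← Real.sin_pi_div_two_sub]
    congr 1
    ring
  rw [h]
  have hx0 : (0.41887 : ℝ) < 2 * π / 15 := by linarith [Real.pi_gt_d6]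
  have hx1 : 2 * π / 15 < (0.41888 : ℝ) := by linarith [Real.pi_lt_d6]
  have hpos : (0 : ℝ) < 2 * π / 15 := by linarith
  have h3 := Real.sin_gt_sub_cube hpos
  have hcube : (2 * π / 15) ^ 3 < (0.41888 : ℝ) ^ 3 := pow_lt_pow_left₀ hx1 hpos.le (by norm_num)
  have hnum : (0.41888 : ℝ) ^ 3 < 0.0735 := by norm_num
  linarith

/-- `cos 96° = -sin 6° > -1/9` (`sin x < x`, `π < 3.15`). [folklore] -/
theorem neg_one_ninth_lt_cos : (-1 : ℝ) / 9 < Real.cos (8 * π / 15) := by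
  have h : Real.cos (8 * π / 15) = -Real.sin (π / 30) := by
    rw [← Real.cos_add_pi_div_two]
    congr 1
    ring
  rw [h]
  have h1 : Real.sin (π / 30) < π / 30 := Real.sin_lt (by positivity)
  linarith [Real.pi_lt_d2]

/-! ## Planar lemmas (unit complex numbers) -/

/-- Pigeonhole on an interval: reals in `[0, 4α)` pairwise more than `α` apart number at
most four (bins `⌊c/α⌋ ∈ {0,1,2,3}`). [folklore] -/
theorem card_le_four_of_sep {ι : Type*} (T : Finset ι) (c : ι → ℝ) {α : ℝ} (hα : 0 < α)
    (h0 : ∀ k ∈ T, 0 ≤ c k) (h4 : ∀ k ∈ T, c k < 4 * α)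
    (h2 : ∀ k ∈ T, ∀ l ∈ T, k ≠ l → α < |c k - c l|) : T.card ≤ 4 := by
  classical
  by_contra! hT
  have hmaps : Set.MapsTo (fun k => ⌊c k / α⌋) (T : Set ι)
      (({0, 1, 2, 3} : Finset ℤ) : Set ℤ) := by
    intro k hk
    rw [Finset.mem_coe] at hk
    have hlo : (0 : ℝ) ≤ c k / α := div_nonneg (h0 k hk) hα.le
    have hhi : c k / α < 4 := by
      rw [div_lt_iff₀ hα]
      linarith [h4 k hk]
    have i1 : (0 : ℤ) ≤ ⌊c k / α⌋ := Int.floor_nonneg.mpr hlo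
    have i2 : ⌊c k / α⌋ < 4 := Int.floor_lt.mpr (by exact_mod_cast hhi)
    simp only [Finset.coe_insert, Finset.coe_singleton, Set.mem_insert_iff,
      Set.mem_singleton_iff]
    omega
  have hcard : ({0, 1, 2, 3} : Finset ℤ).card < T.card := lt_of_le_of_lt Finset.card_le_four hT
  obtain ⟨k, hk, l, hl, hne, hfeq⟩ := Finset.exists_ne_map_eq_of_card_lt_of_maps_to hcard hmaps
  have h1 := Int.abs_sub_lt_one_of_floor_eq_floor hfeq
  have hlt : |c k - c l| < α := by
    rw [← sub_div, abs_div, abs_of_pos hα, div_lt_one hα] at h1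
    exact h1
  linarith [h2 k hk l hl hne]

/-- Real part of `z conj w` in coordinates. [folklore] -/
theorem re_mul_conj (z w : ℂ) : (z * conj w).re = z.re * w.re + z.im * w.im := by
  simp only [Complex.mul_re, Complex.conj_re, Complex.conj_im]
  ring

/-- Imaginary part of `z conj w` in coordinates. [folklore] -/
theorem im_mul_conj (z w : ℂ) : (z * conj w).im = z.im * w.re - z.re * w.im := by
  simp only [Complex.mul_im, Complex.conj_re, Complex.conj_im]
  ring

/-- **Core angular lemma.**  Among at least five unit complex numbers `w n` (`n ∈ S`) with
`w l = 1` and pairwise `Re (w n conj (w n')) ≤ 2/5` (angles `> 66°`), some `w m ≠ w l` in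
the open UPPER half plane has `Re (w m) > -1/9` (angle from `1` less than `96°`): otherwise,
measuring angles clockwise from `1`, the first point met counter-clockwise is `> 96°` away
and all five points fit in an arc `< 4·66°` pairwise `> 66°` apart — pigeonhole. [folklore] -/
theorem exists_partner_of_five {ι : Type*} (S : Finset ι) (w : ι → ℂ) (l : ι) (hl : l ∈ S)
    (hS : 4 < S.card) (h1 : ∀ n ∈ S, ‖w n‖ = 1) (hwl : w l = 1)
    (hsep : ∀ n ∈ S, ∀ n' ∈ S, n ≠ n' → (w n * conj (w n')).re ≤ 2 / 5) :
    ∃ m ∈ S, m ≠ l ∧ 0 < (w m).im ∧ -1 / 9 < (w m).re := by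
  classical
  by_contra! H
  have hpi : 0 < π := Real.pi_pos
  have hre : ∀ n ∈ S, Real.cos (Complex.arg (w n)) = (w n).re := fun n hn => by
    have := Complex.norm_mul_cos_arg (w n)
    rwa [h1 n hn, one_mul] at this
  have him : ∀ n ∈ S, Real.sin (Complex.arg (w n)) = (w n).im := fun n hn => by
    have := Complex.norm_mul_sin_arg (w n)
    rwa [h1 n hn, one_mul] at this
  -- clockwise angle from `w l = 1`, in `[0, 2π)`
  obtain ⟨c, hc⟩ : ∃ c : ι → ℝ, ∀ n, c n =
      if 0 < Complex.arg (w n) then 2 * π - Complex.arg (w n) else -Complex.arg (w n) :=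
    ⟨_, fun _ => rfl⟩
  have hcos : ∀ n ∈ S, Real.cos (c n) = (w n).re := by
    intro n hn
    rw [hc]
    split_ifs with h
    · rw [Real.cos_two_pi_sub]
      exact hre n hn
    · rw [Real.cos_neg]
      exact hre n hn
  have hsin : ∀ n ∈ S, Real.sin (c n) = -(w n).im := by
    intro n hn
    rw [hc]
    split_ifs with h
    · rw [Real.sin_two_pi_sub, him n hn]
    · rw [Real.sin_neg, him n hn]
  have hc0 : ∀ n, 0 ≤ c n := by
    intro n
    rw [hc]
    split_ifs with h
    · linarith [Complex.arg_le_pi (w n)]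
    · linarith
  have hcπ : ∀ n, ¬ 0 < Complex.arg (w n) → c n < π := by
    intro n h
    rw [hc, if_neg h]
    linarith [Complex.neg_pi_lt_arg (w n)]
  -- pairwise separation `> 66°`
  have hsepc : ∀ n ∈ S, ∀ n' ∈ S, n ≠ n' → 11 * π / 30 < |c n - c n'| := by
    intro n hn n' hn' hne
    by_contra! hle
    have hcosdiff : Real.cos (c n - c n') = (w n * conj (w n')).re := by
      rw [Real.cos_sub, hcos n hn, hcos n' hn', hsin n hn, hsin n' hn', re_mul_conj]
      ring
    have hge : Real.cos (11 * π / 30) ≤ Real.cos (c n - c n') := by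
      rw [← Real.cos_abs (c n - c n')]
      exact Real.cos_le_cos_of_nonneg_of_le_pi (abs_nonneg _) (by linarith) hle
    linarith [hsep n hn n' hn' hne, two_fifths_lt_cos]
  have hal : Complex.arg (w l) = 0 := by rw [hwl, Complex.arg_one]
  set pos := S.filter fun n => 0 < Complex.arg (w n) with hpos
  rcases pos.eq_empty_or_nonempty with hemp | hne
  · have h4 : ∀ k ∈ S, c k < 4 * (11 * π / 30) := by
      intro k hk
      have hk' : ¬ 0 < Complex.arg (w k) := by
        intro h
        have : k ∈ pos := Finset.mem_filter.mpr ⟨hk, h⟩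
        rw [hemp] at this
        exact absurd this (Finset.notMem_empty _)
      linarith [hcπ k hk']
    have := card_le_four_of_sep S c (α := 11 * π / 30) (by positivity) (fun k _ => hc0 k) h4 hsepc
    omega
  · obtain ⟨m, hm, hmin⟩ := Finset.exists_min_image pos (fun n => Complex.arg (w n)) hne
    rw [Finset.mem_filter] at hm
    obtain ⟨hmS, hma⟩ := hm
    have hml : m ≠ l := by
      rintro rfl
      rw [hal] at hma
      exact lt_irrefl _ hma
    have hre_m : (w m).re ≤ -1 / 9 := by
      by_cases hi : 0 < (w m).im
      · exact H m hmS hml hi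
      · push Not at hi
        have hamπ : Complex.arg (w m) = π := by
          by_contra hne'
          have hlt : Complex.arg (w m) < π := lt_of_le_of_ne (Complex.arg_le_pi _) hne'
          have := Real.sin_pos_of_pos_of_lt_pi hma hlt
          rw [him m hmS] at this
          linarith
        have := hre m hmS
        rw [hamπ, Real.cos_pi] at this
        linarith
    have ham : 8 * π / 15 < Complex.arg (w m) := by
      by_contra! hle
      have h := Real.cos_le_cos_of_nonneg_of_le_pi hma.le (by linarith) hle
      rw [hre m hmS] at h
      linarith [neg_one_ninth_lt_cos]
    have hcm : c m = 2 * π - Complex.arg (w m) := by rw [hc, if_pos hma]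
    have hcle : ∀ n ∈ S, c n ≤ c m := by
      intro n hn
      by_cases h : 0 < Complex.arg (w n)
      · have := hmin n (Finset.mem_filter.mpr ⟨hn, h⟩)
        rw [hc n, if_pos h, hcm]
        linarith
      · have := hcπ n h
        rw [hcm]
        linarith [Complex.arg_le_pi (w m)]
    have h4 : ∀ k ∈ S, c k < 4 * (11 * π / 30) := fun k hk => by linarith [hcle k hk]
    have := card_le_four_of_sep S c (α := 11 * π / 30) (by positivity) (fun k _ => hc0 k) h4 hsepc
    omega

/-- Mirror image of `exists_partner_of_five`: a partner in the open LOWER half plane.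
[folklore] -/
theorem exists_partner_of_five' {ι : Type*} (S : Finset ι) (w : ι → ℂ) (l : ι) (hl : l ∈ S)
    (hS : 4 < S.card) (h1 : ∀ n ∈ S, ‖w n‖ = 1) (hwl : w l = 1)
    (hsep : ∀ n ∈ S, ∀ n' ∈ S, n ≠ n' → (w n * conj (w n')).re ≤ 2 / 5) :
    ∃ m ∈ S, m ≠ l ∧ (w m).im < 0 ∧ -1 / 9 < (w m).re := by
  obtain ⟨m, hm, hml, him, hre⟩ := exists_partner_of_five S (fun n => conj (w n)) l hl hS
    (fun n hn => by rw [Complex.norm_conj]; exact h1 n hn) (by simp [hwl])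
    (fun n hn n' hn' hne => by
      have h := hsep n hn n' hn' hne
      rw [re_mul_conj] at h ⊢
      simp only [Complex.conj_re, Complex.conj_im]
      linarith)
  refine ⟨m, hm, hml, ?_, ?_⟩
  · simp only [Complex.conj_im] at him
    linarith
  · simpa using hre

/-- **At most two bonded partners.**  Unit complex numbers with real parts in `[0, 2/5]`
(angle from `1` between `66°` and `90°`) and pairwise `Re (w n conj (w n')) ≤ 2/5` number at
most two: two of any three lie in the same closed half plane, and then
`Re (w n conj (w n')) ≥ Im (w n) Im (w n') ≥ 21/25`. [folklore] -/
theorem card_le_two_of_re_nonneg {ι : Type*} (T : Finset ι) (w : ι → ℂ)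
    (h1 : ∀ n ∈ T, ‖w n‖ = 1) (hre0 : ∀ n ∈ T, 0 ≤ (w n).re)
    (hre1 : ∀ n ∈ T, (w n).re ≤ 2 / 5)
    (hsep : ∀ n ∈ T, ∀ n' ∈ T, n ≠ n' → (w n * conj (w n')).re ≤ 2 / 5) : T.card ≤ 2 := by
  classical
  by_contra! hT
  obtain ⟨p, hp, q, hq, r, hr, hpq, hpr, hqr⟩ := Finset.two_lt_card.mp hT
  have hunit : ∀ n ∈ T, (w n).re ^ 2 + (w n).im ^ 2 = 1 := fun n hn => by
    have h := Complex.sq_norm (w n)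
    rw [Complex.normSq_apply, h1 n hn, one_pow] at h
    nlinarith [h]
  have him2 : ∀ n ∈ T, 21 / 25 ≤ (w n).im ^ 2 := fun n hn => by
    nlinarith [hunit n hn, hre0 n hn, hre1 n hn]
  have key : ∀ n ∈ T, ∀ n' ∈ T, n ≠ n' → 0 ≤ (w n).im * (w n').im → False := by
    intro n hn n' hn' hne hprod
    have h := hsep n hn n' hn' hne
    rw [re_mul_conj] at h
    have hsq : (21 / 25 : ℝ) * (21 / 25) ≤ ((w n).im * (w n').im) ^ 2 := by
      rw [mul_pow]
      exact mul_le_mul (him2 n hn) (him2 n' hn') (by norm_num) (le_trans (by norm_num) (him2 n hn))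
    have hge : 21 / 25 ≤ (w n).im * (w n').im := by nlinarith
    nlinarith [mul_nonneg (hre0 n hn) (hre0 n' hn')]
  rcases le_total 0 (w p).im with h1p | h1p <;> rcases le_total 0 (w q).im with h1q | h1q <;>
    rcases le_total 0 (w r).im with h1r | h1r
  · exact key p hp q hq hpq (mul_nonneg h1p h1q)
  · exact key p hp q hq hpq (mul_nonneg h1p h1q)
  · exact key p hp r hr hpr (mul_nonneg h1p h1r)
  · exact key q hq r hr hqr (mul_nonneg_of_nonpos_of_nonpos h1q h1r)
  · exact key q hq r hr hqr (mul_nonneg h1q h1r)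
  · exact key p hp r hr hpr (mul_nonneg_of_nonpos_of_nonpos h1p h1r)
  · exact key p hp q hq hpq (mul_nonneg_of_nonpos_of_nonpos h1p h1q)
  · exact key p hp q hq hpq (mul_nonneg_of_nonpos_of_nonpos h1p h1q)

/-! ## Scalar lemmas: the transversal radius band and the three cosine bounds -/

/-- Transversal radius of a common neighbour, upper bound: if `A = ρ² + s² ≤ 1`,
`B = ρ² + (s - d)² ≤ 1` and `d ≥ 55/57` then `ρ² ≤ 1 - (55/57)²/4 = 9971/12996`. [folklore] -/
theorem transversal_sq_le {d A B ρ2 s : ℝ} (hd1 : 55 / 57 ≤ d) (hA2 : A ≤ 1) (hB2 : B ≤ 1)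
    (hA : A = ρ2 + s ^ 2) (hB : B = ρ2 + (s - d) ^ 2) : ρ2 ≤ 9971 / 12996 := by
  have h1 : 2 * ρ2 = A + B - d ^ 2 / 2 - (2 * s - d) ^ 2 / 2 := by
    rw [hA, hB]
    ring
  have hd2 : (55 / 57 : ℝ) ^ 2 ≤ d ^ 2 := pow_le_pow_left₀ (by norm_num) hd1 2
  nlinarith [sq_nonneg (2 * s - d)]

/-- Transversal radius of a common neighbour, lower bound: if moreover `A, B ≥ (55/57)²` and
`d ≤ 1` then `ρ² ≥ (55/57)² - 1/4 - (1 - (55/57)²)²/(4 (55/57)²) ≥ 0.6796`. [folklore] -/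
theorem transversal_sq_ge {d A B ρ2 s : ℝ} (hd1 : 55 / 57 ≤ d) (hd2 : d ≤ 1)
    (hA1 : (55 / 57 : ℝ) ^ 2 ≤ A) (hA2 : A ≤ 1) (hB1 : (55 / 57 : ℝ) ^ 2 ≤ B) (hB2 : B ≤ 1)
    (hA : A = ρ2 + s ^ 2) (hB : B = ρ2 + (s - d) ^ 2) : (6796 : ℝ) / 10000 ≤ ρ2 := by
  have hsd : (2 * s - d) * d = A - B := by
    rw [hA, hB]
    ring
  have hAB : (A - B) ^ 2 ≤ (224 / 3249 : ℝ) ^ 2 := by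
    rw [← sq_abs (A - B)]
    exact pow_le_pow_left₀ (abs_nonneg _) (abs_le.mpr ⟨by nlinarith, by nlinarith⟩) 2
  have hdd : (55 / 57 : ℝ) ^ 2 ≤ d ^ 2 := pow_le_pow_left₀ (by norm_num) hd1 2
  have ht : (2 * s - d) ^ 2 ≤ 50176 / 9828225 := by
    by_contra! h
    have e : ((2 * s - d) * d) ^ 2 = (2 * s - d) ^ 2 * d ^ 2 := by ring
    have h3 : (2 * s - d) ^ 2 * (55 / 57 : ℝ) ^ 2 ≤ (2 * s - d) ^ 2 * d ^ 2 :=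
      mul_le_mul_of_nonneg_left hdd (sq_nonneg _)
    rw [hsd] at e
    nlinarith
  have h1 : 2 * ρ2 = A + B - d ^ 2 / 2 - (2 * s - d) ^ 2 / 2 := by
    rw [hA, hB]
    ring
  have hd21 : d ^ 2 ≤ 1 := pow_le_one₀ (by linarith) hd2
  nlinarith

/-- All pairs: radii in the band and `|P_k - P_l|² ≥ (55/57)² - 3/500` give
`⟪P_k, P_l⟫ ≤ (2/5) |P_k| |P_l|`. [folklore] -/
theorem inner_le_two_fifths_mul {ρk ρl ip n2 : ℝ} (hk1 : 0.8243 ≤ ρk) (hk2 : ρk ≤ 0.876)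
    (hl1 : 0.8243 ≤ ρl) (hl2 : ρl ≤ 0.876) (hk : ρk ^ 2 ≤ 9971 / 12996)
    (hl : ρl ^ 2 ≤ 9971 / 12996) (hn : n2 = ρk ^ 2 - 2 * ip + ρl ^ 2)
    (hn2 : (55 / 57 : ℝ) ^ 2 - 3 / 500 ≤ n2) : ip ≤ 2 / 5 * (ρk * ρl) := by
  have h1 : ρk ^ 2 - 2 * (ρk * ρl) + ρl ^ 2 ≤ 0.0517 ^ 2 := by
    nlinarith [mul_nonneg (show (0 : ℝ) ≤ 0.0517 - (ρk - ρl) by linarith)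
      (show (0 : ℝ) ≤ ρk - ρl + 0.0517 by linarith)]
  nlinarith

/-- Far pairs: `|P_k - P_l|² ≥ (131/100)² - 3/500` gives `⟪P_k, P_l⟫ ≤ -(1/9) |P_k| |P_l|`.
[folklore] -/
theorem inner_le_neg_ninth_mul {ρk ρl ip n2 : ℝ}
    (hk : ρk ^ 2 ≤ 9971 / 12996) (hl : ρl ^ 2 ≤ 9971 / 12996)
    (hn : n2 = ρk ^ 2 - 2 * ip + ρl ^ 2) (hn2 : (131 / 100 : ℝ) ^ 2 - 3 / 500 ≤ n2) :
    ip ≤ -(1 / 9) * (ρk * ρl) := by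
  nlinarith [sq_nonneg (ρk - ρl)]

/-- Bonded pairs: `|P_k - P_l|² ≤ 1` and radii `≥ 0.824` give `⟪P_k, P_l⟫ > 0`. [folklore] -/
theorem inner_pos_of_bonded {ρk ρl ip n2 : ℝ} (hk : (6796 : ℝ) / 10000 ≤ ρk ^ 2)
    (hl : (6796 : ℝ) / 10000 ≤ ρl ^ 2) (hn : n2 = ρk ^ 2 - 2 * ip + ρl ^ 2) (hn2 : n2 ≤ 1) :
    0 < ip := by
  nlinarith


end Summit.AtomisticToContinuum.Crystallization.Theorems.SquareWellLayerCakeGapTwelveToBarlow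

end
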